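import Summits.ABC.IUTFork.Repair.RHRound4ConstraintRequirements
import Summits.ABC.IUTFork.Repair.RHRound4ConstraintRequirementsB
import Summits.ABC.IUTFork.Repair.RHRound4ConstraintRequirementsC
import Summits.ABC.IUTFork.Repair.RHReqsideShellProfile
import HarnessLib

/-!
# R-H ROUND 4 — KERNEL FACES for the EVEN constraint sheets V2 (census O-11: netting scope / LP tiers), V4 + V4B (O-13: free label measure,
# oriented labels), V6 (O-15: floor rounding / containers) — the sheets' closed forms and KILLED words made kernel-exact, PROOF-ONLY

abc-iut cell, rung LADDER-ABC:A2.RESCUE.H; seat abc-iut-rh2-w-1 (GEN 6; KEY `wake/KEY-abc-iut-rh2-w-1-R4FACE-EVEN.md`, abc-iut-rh-lead g5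
(OPENINGS-CENSUS pen) 2026-08-27T14:54:40Z under director-abc g6-D15 (4) «EVEN → rh2-w-1, ODD → rh2-q2-eq» and HUMAN D-0133 · D-0134 · D-0135;
referee rh-ref-2). Sources read first-hand: sheets `ROUND4/R4-7-V2-abc-iut-rh3-gen-2.md` 70044926efab903c, `R4-7-V4-abc-iut-rh3-gen-4.md`
a251bf4a1549629f + `R4-7-V4B-…` 23dbb0dfaaa08765, `R4-7-V6-abc-iut-rh3-gen-5.md` 776c7c62401f99ce; beds `R4-7-BED-V2/V4/V6-rh3-tst-2.tsv`; census
v0.11 rows O-11/O-13/O-15; abc-iut-L5-t8's requirement vocabulary `Repair/RHRound4ConstraintRequirements{,B,C}.lean` (★ p539032 / ★ p539557 / part C)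
cited BY NAME, nothing re-declared; FENCE p488865 `RHLabelWeightSchemes`; k3 faces p507493 `RHReqsideShellProfile`. Per sheet: (α) the closed forms
behind the (c)-numbers, (β) «residual requirement ⟹ census word» over L5-t8's `Prop`s, (γ) the V4B inertness lemma over an explicit finite label type.
* §V2 (O-11): (α) SCOPE CHAIN cells ≼ places ≼ datum (`NettingRowScoped` singletons `→ NettingRowWithin → NettingRow`) and LP-TIER chain NONE ≤
  WITHIN ≤ ACROSS at the value level; (β) `V2_B5_poolMediant` PROVED (widenings keep exponent `−1`) and «`V2_requirement` at every member ⟹ family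
  netting closes every member» (netting alone closes only SOME member, `exists_statement_of_netAcrossFamily`).
* §V4 (O-13) + V4B: (α) `lawConstant` closed forms — top-supported law `2l/(l⋆−1) = 4l/(l−3)` (FENCE minimum), uniform law
  `2l·3(l⋆+3)/((l⋆−1)(2l⋆+5))`, every law `≥ 2l/(l⋆−1)`, G-split factor `(2l⋆+5)/(3(l⋆+3)) = 2(l+4)/(3(l+5))`, bed check
  `G ≥ μ_D1·(2l⋆+5)/(3(l⋆+3))`; (β) `V4_B6_labelLawDoor` at the uniform law IS p480491's weighted door (missing exactly for `ν ≠ 1/l⋆`),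
  `V4_B5_reqM2 … → ¬ IsPretransitive` (an `r ≥ 2`-orbit indexing denies the instance of the M2 forcing lemma), V4B A2's trivial symmetry;
  (γ) INERTNESS: for a column even under an involution (`t ↦ −t` on `ZMod l`) every `Σ_t ν_t·col_t` and every E-type quotient depends on `ν` only
  through `t ↦ ν_t + ν_{−t}` — orientation alone is count-neutral.
* §V6 (O-15): (α) ledger identity `thr(floor) = thr(none) − ρ_j` and the FLOOR-ROUNDING MEETS LAW (licensed(none) ⊆ licensed(floor) cellwise by
  `roundingNoneCell_le_print` ⇒ kept and MEETS only FALL when the floor is removed); (β) `V6_R1_orbitModuleRigidity ⟹` no finer stable filtration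
  BY SUBGROUPS (sheet R-V6-1's own signature; L5-t8's `V6_R1_finerStableFiltration` weakens `Fil` to bare sets, where the obstruction is silent)
  for any refinement index `e ≥ 2` whose group contains the log-packet automorphisms — KILLED-BY-CONSISTENCY modulo the typed obstruction.
HONEST FRAMING / GUARDS: PROOF-ONLY (0 definitions, 0 `Prop` facts, no `instance` / `notation` / `macro`; no Literature fact — FROZEN FACT-LIST
f75a60bac22efdb6); every theorem is elementary arithmetic / finite algebra / one-line logic about OUR typed cell currency and L5-t8's claim-tagged
requirement `Prop`s; a KILLED word here is a kernel identity between typed statements, never a claim about [IUTchI–IV]; located ≠ adjudicated;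
typed ≠ proved; computed ≠ proved; no side on [IUTchIII] Cor 3.12 / Rmk 3.9.3 / [IUTchIV] Thm 1.10 / Prop 1.2 or on any author (D-0045); nothing
here asserts that abc is proved or refuted. [claim: Mochizuki2012, status: disputed] for every IUT locution. [cite: Mochizuki2012, IUTchIII
Cor. 3.12 p. 173–174, Rmk. 3.9.3 p. 119–120; IUTchIV Prop. 1.2 p. 10–11, Thm. 1.10 Step (v)–(viii) p. 27–30; IUTchI Prop. 4.9 p. 115, Prop. 6.8 p. 168]
-/

noncomputable section

open Finset

namespace Summit.ABC.IUTFork.Repair.RH.Round4ConstraintFacesEven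

open Summit.ABC.IUTFork.Repair.RH.Round4ConstraintRequirements

/-! ## §V2. Sheet V2 (census O-11) — the netting row's SCOPE CHAIN and the LP TIERS, kernel-exact -/

section V2Scopes
variable {ι 𝕜 : Type*} [Field 𝕜] [LinearOrder 𝕜] [IsStrictOrderedRing 𝕜]

/-- **(α) Scope chain, constraint level, cells ≼ places** (sheet V2 §0 «finest to coarsest: cells (scope NONE) ≼ places (WITHIN) ≼ datum (ACROSS);
coarser `𝒫` ⇒ weaker constraint»): the per-cell rows (`NettingRowScoped` over the singletons of the table `s`, L5-t8's scope NONE) imply the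
per-place rows `NettingRowWithin` for any place system whose cells lie in `s`. [folklore] -/
theorem nettingRowWithin_of_scopedSingletons [DecidableEq ι] {W : Type*} {s : Finset ι} {places : Finset W} {cells : W → Finset ι}
    {ŝ ω : ι → 𝕜} (hsub : ∀ w ∈ places, cells w ⊆ s) (h : NettingRowScoped (s.image fun c => ({c} : Finset ι)) ŝ ω) :
    NettingRowWithin places cells ŝ ω := fun w hw =>
  Finset.sum_nonneg fun c hc => by
    have h1 := h {c} (Finset.mem_image.mpr ⟨c, hsub w hw hc, rfl⟩)
    rwa [Finset.sum_singleton] at h1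

/-- **(α) Scope chain, constraint level, places ≼ datum**: for a place system partitioning the table (cells pairwise disjoint) the per-place rows
`NettingRowWithin` imply print's single row `NettingRow` over `⋃_w cells w` — WITHIN is STRICTER than print (sheet (b) B0′; census «CONSISTENT-STRICTER
(our typing)»). [folklore] -/
theorem nettingRow_of_nettingRowWithin [DecidableEq ι] {W : Type*} {places : Finset W} {cells : W → Finset ι} {ŝ ω : ι → 𝕜}
    (hdisj : (places : Set W).PairwiseDisjoint cells) (h : NettingRowWithin places cells ŝ ω) :
    NettingRow (places.biUnion cells) ŝ ω := by
  unfold NettingRow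
  rw [Finset.sum_biUnion hdisj]
  exact Finset.sum_nonneg fun w hw => h w hw

/-- **(α) LP tiers, value level: NONE ≤ WITHIN on every group** (LP currency p488805 / p490154: cells `G`, masses `t ≥ 0`, model slacks `ŝ`, licensed
`ŝ ≥ 0`; the group's netted optimum `min(Σ_G t, Σ_{ŝ≥0}(t + ŝ)) = min(M_G, mass(σ_G) + C_G)` is `ToptKnapsackDegenerate.exists_kept_eq_min`): the
licence-only kept mass `mass(σ_G)` is at most the netted optimum — bed `μ₄ ≤ L0a`, `μ_L1 ≤ L1a` (0.578 ≤ 0.665, 0.862 ≤ 0.909 FREY133). [folklore] -/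
theorem noneOptimum_le_withinOptimum (G : Finset ι) (t ŝ : ι → 𝕜) (ht : ∀ c ∈ G, 0 ≤ t c) :
    ∑ c ∈ G.filter (fun c => 0 ≤ ŝ c), t c ≤ min (∑ c ∈ G, t c) (∑ c ∈ G.filter (fun c => 0 ≤ ŝ c), (t c + ŝ c)) :=
  le_min (Finset.sum_le_sum_of_subset_of_nonneg (Finset.filter_subset _ _) fun c hc _ => ht c hc)
    (Finset.sum_le_sum fun c hc => by
      have h0 : 0 ≤ ŝ c := (Finset.mem_filter.mp hc).2
      linarith)

/-- **(α) LP tiers, value level: WITHIN ≤ ACROSS** (superadditivity of `min`): the per-place netted optima `min(M_w, mass(σ_w) + C_w)` summed over a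
place system partitioning the table are at most the single-row (print-scope) optimum `min(M, mass(σ) + C)` — bed `L0a ≤ L0b`, `L1a ≤ L1b` (0.665 ≤
0.9995, 0.909 ≤ 1.000 FREY133; census O-11 «KILLED-BY-DATA for every scope none ≼ within ≼ datum»: wider keeps MORE, exponent stays `−1`). [folklore] -/
theorem withinOptimum_le_acrossOptimum [DecidableEq ι] {W : Type*} (places : Finset W) (cells : W → Finset ι)
    (hdisj : (places : Set W).PairwiseDisjoint cells) (t ŝ : ι → 𝕜) :
    ∑ w ∈ places, min (∑ c ∈ cells w, t c) (∑ c ∈ (cells w).filter (fun c => 0 ≤ ŝ c), (t c + ŝ c)) ≤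
      min (∑ c ∈ places.biUnion cells, t c) (∑ c ∈ (places.biUnion cells).filter (fun c => 0 ≤ ŝ c), (t c + ŝ c)) := by
  have hdisj' : (places : Set W).PairwiseDisjoint (fun w => (cells w).filter fun c => 0 ≤ ŝ c) :=
    hdisj.mono fun w => Finset.filter_subset _ (cells w)
  rw [Finset.filter_biUnion, Finset.sum_biUnion hdisj, Finset.sum_biUnion hdisj']
  exact le_min (Finset.sum_le_sum fun w _ => min_le_left _ _) (Finset.sum_le_sum fun w _ => min_le_right _ _)
end V2Scopes

section V2Doors
open Summit.ABC.IUTFork.Repair.RH.HeightScaling Summit.ABC.IUTFork Summit.ABC.IUTFork.Thm311 Summit.ABC.IUTFork.Cor312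
  Summit.ABC.IUTFork.Cor312.Setting Summit.ABC.IUTFork.Repair.RH.SigmaLicence

/-- **(β) `V2_B5_poolMediant` HOLDS** (L5-t8's `Prop`, sheet (b) B5; census O-11 «widenings B1/B2 … exponent-inert (−1 EXACTLY, mediant law)»): the
`ν·M`-weighted mean of finitely many profiles of height-exponent `−1` has exponent `−1` with constant any common bound of the members' constants —
netting ACROSS a fixed finite family of primes / curves never changes the exponent of AXIS-D2 rows 3/5 (cf. `HeightScalingMultiL.exponentAtMost_pool`). [folklore] -/
theorem V2_B5_poolMediant_holds : V2_B5_poolMediant := by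
  intro n f M ν C Cmax hν hM hνM hf hC s hs
  show (∑ i, ν i * M i * f i s) / ∑ i, ν i * M i ≤ Cmax * s ^ (-1 : ℝ)
  rw [div_le_iff₀ hνM]
  have hs0 : (0 : ℝ) ≤ s ^ (-1 : ℝ) := Real.rpow_nonneg (by linarith) _
  calc ∑ i, ν i * M i * f i s ≤ ∑ i, ν i * M i * (C i * s ^ (-1 : ℝ)) :=
        Finset.sum_le_sum fun i _ => mul_le_mul_of_nonneg_left (hf i s hs) (mul_nonneg (hν i) (hM i).le)
    _ ≤ ∑ i, ν i * M i * (Cmax * s ^ (-1 : ℝ)) :=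
        Finset.sum_le_sum fun i _ =>
          mul_le_mul_of_nonneg_left (mul_le_mul_of_nonneg_right (hC i) hs0) (mul_nonneg (hν i) (hM i).le)
    _ = Cmax * s ^ (-1 : ℝ) * ∑ i, ν i * M i := by
        rw [Finset.mul_sum]
        exact Finset.sum_congr rfl fun i _ => by ring

variable {K : Type*} {T : K → ThetaIndex} {S : (k : K) → Situation (T k)} in
/-- **(β) The transfer door is EXACTLY what turns a wider netting scope into every member's Corollary** (census O-11 residual «`XferLaw C Λ l₀` … the
only object that turns a wider netting scope into mass for ONE requirement»): L5-t8's `V2_requirement Λ P ν k₀ 0` at EVERY member makes family netting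
yield EVERY member's Statement — netting alone yields only SOME member (`exists_statement_of_netAcrossFamily`). [claim: Mochizuki2012, status: disputed] -/
theorem forall_statement_of_forall_requirement {Λ : Finset K} {P : (k : K) → Cor312.Setting (S k)} {ν : K → ℝ}
    (hreq : ∀ k₀ ∈ Λ, V2_requirement Λ P ν k₀ 0) (hnet : V2_netAcrossFamily Λ P ν) :
    ∀ k ∈ Λ, (P k).Statement := fun k hk => by
  have h := hreq k hk hnet
  rwa [statementUpTo_zero_iff] at h
end V2Doors

/-! ## §V4. Sheet V4 (census O-13) and V4B — the label-law constant in closed form, the doors BY NAME, the inertness lemma -/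

section V4Constant
variable {n : ℕ}

/-- A label law supported on the top label `j = n` IS the point mass `δ_n` (total weight `1`). [folklore] -/
theorem law_eq_topIndicator (L : LabelLaw n) (htop : ∀ i : Fin n, (i : ℕ) + 1 ≠ n → L.ν i = 0) (i : Fin n) :
    L.ν i = if (i : ℕ) + 1 = n then 1 else 0 := by
  split_ifs with hi
  · have htot := L.total
    rw [Finset.sum_eq_single i (fun j _ hj => htop j fun hj' => hj (Fin.ext (by omega)))
      (fun h => absurd (Finset.mem_univ i) h)] at htot
    exact htot
  · exact htop i hi

/-- **(α) TOP LAW: `C(δ_{l⋆}, l) = 2l/(l⋆ − 1)`** — L5-t8's `lawConstant` at a law supported on the top label is the FENCE minimum (sheet V4B (c) C2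
«C(ν⋆, l) = C(δ_{l⋆}, l) = 4l/(l−3) EXACTLY = the FENCE minimum»; bed V4: ν⋆ = δ_{l⋆} on 1,388/1,388 datum-sides), via `topLabel_gap/_slots`; in
`l = 2l⋆+1` currency `2l/(l⋆−1) = 4l/(l−3) → 4` is FENCE `CellWeights.topConstant_eq`. [folklore] -/
theorem lawConstant_of_top (hn : 2 ≤ n) (l : ℕ) (L : LabelLaw n) (htop : ∀ i : Fin n, (i : ℕ) + 1 ≠ n → L.ν i = 0) :
    lawConstant l L = 2 * (l : ℝ) / ((n : ℝ) - 1) := by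
  have hν : ∀ i, L.ν i = if (i : ℕ) + 1 = n then 1 else 0 := law_eq_topIndicator L htop
  unfold lawConstant
  simp_rw [hν]
  rw [CellWeights.topLabel_slots (by omega), CellWeights.topLabel_gap (by omega)]
  have h2 : (2 : ℝ) ≤ n := by exact_mod_cast hn
  have h1 : (n : ℝ) - 1 ≠ 0 := by linarith
  have h3 : (n : ℝ) + 1 ≠ 0 := by linarith
  have hsq : (n : ℝ) ^ 2 - 1 = ((n : ℝ) - 1) * ((n : ℝ) + 1) := by ring
  rw [hsq]
  field_simp

/-- **(α) UNIFORM LAW (print): `C(u, l) = 2l·3(l⋆+3)/((l⋆−1)(2l⋆+5))`** — `lawConstant` at `LabelLaw.uniform` is `2l` times the FENCE uniform ratio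
(`uniformRatio_eq` BY NAME); in `l = 2l⋆+1` currency this is `6l(l+5)/((l−3)(l+4)) → 6` (`CellWeights.uniformConstant_eq`). [folklore] -/
theorem lawConstant_uniform (hn : 2 ≤ n) (h0 : 0 < n) (l : ℕ) :
    lawConstant l (LabelLaw.uniform h0) = 2 * (l : ℝ) * (3 * ((n : ℝ) + 3) / (((n : ℝ) - 1) * (2 * n + 5))) := by
  have hν : ∀ i : Fin n, (LabelLaw.uniform h0).ν i = 1 / (n : ℝ) := LabelLaw.uniform_isUniform h0
  unfold lawConstant
  simp_rw [hν]
  rw [← Finset.mul_sum, ← Finset.mul_sum, ← CellWeights.uniformRatio_eq hn, mul_div_assoc,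
    mul_div_mul_left _ _ (by positivity : (1 : ℝ) / (n : ℝ) ≠ 0)]

/-- **(α) FENCE BY NAME: every law with positive gap side has `C(ν, l) ≥ 2l/(l⋆−1) = C(δ_{l⋆}, l)`** (L5-t8's `lawConstant_gapSide_le` = FENCE
`weightedSqSubOne_le`; census O-13 «any ν changes the constant to C(ν,l) ∈ [4l/(l−3), ∞)»). [folklore] -/
theorem topConstant_le_lawConstant (hn : 2 ≤ n) (l : ℕ) (L : LabelLaw n)
    (hgap : 0 < ∑ i : Fin n, L.ν i * ((((i : ℕ) : ℝ) + 1) ^ 2 - 1)) :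
    2 * (l : ℝ) / ((n : ℝ) - 1) ≤ lawConstant l L := by
  unfold lawConstant
  have hF := lawConstant_gapSide_le L
  have h2 : (2 : ℝ) ≤ n := by exact_mod_cast hn
  have hn1 : (0 : ℝ) < (n : ℝ) - 1 := by linarith
  rw [div_le_div_iff₀ hn1 hgap]
  have hl : (0 : ℝ) ≤ 2 * (l : ℝ) := by positivity
  have := mul_le_mul_of_nonneg_left hF hl
  nlinarith

/-- **(α) THE G-SPLIT CONSTANT FACTOR `C(δ_{l⋆})/C(u) = (2l⋆+5)/(3(l⋆+3)) = 2(l+4)/(3(l+5))`** (`l = 2l⋆+1`; sheet V4B (c) C2 «G = [4l/(l−3) ÷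
6l(l+5)/((l−3)(l+4))] × [μ_D1/μ_top] = [2(l+4)/(3(l+5))] × [μ_D1/μ_top]»; survives `l → ∞` as `2/3`; any `l > 0` in front cancels). [folklore] -/
theorem topConstant_div_uniformConstant (hn : 2 ≤ n) {l : ℝ} (hl : 0 < l) :
    (2 * l / ((n : ℝ) - 1)) / (2 * l * (3 * ((n : ℝ) + 3) / (((n : ℝ) - 1) * (2 * n + 5)))) =
      2 * ((2 * (n : ℝ) + 1) + 4) / (3 * ((2 * (n : ℝ) + 1) + 5)) := by
  have h2 : (2 : ℝ) ≤ n := by exact_mod_cast hn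
  have h1 : (n : ℝ) - 1 ≠ 0 := by linarith
  have h3 : (2 * (n : ℝ) + 1) + 5 ≠ 0 := by linarith
  have h5 : 2 * (n : ℝ) + 5 ≠ 0 := by linarith
  have hl0 : l ≠ 0 := hl.ne'
  field_simp
  ring

/-- **(α) THE BED CHECK `G(T) ≥ μ_D1(T)·(2l⋆+5)/(3(l⋆+3))`** (sheet V4 (c) C3 «a violation is an engine error»; holds 1,388/1,388 on bed V4): with
`G = [C_ν/C_u]·[μ_u/μ_ν]`, `C_ν ≥ C_top ≥ 0` (FENCE), `C_u > 0`, `0 < μ_ν ≤ 1`, `μ_u ≥ 0`: `(C_top/C_u)·μ_u ≤ G`. [folklore] -/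
theorem constantFactor_mul_kept_le_gain {Cν Cu Ctop μu μν : ℝ} (hCu : 0 < Cu) (hCtop : 0 ≤ Ctop) (htop : Ctop ≤ Cν)
    (hμν0 : 0 < μν) (hμν1 : μν ≤ 1) (hμu : 0 ≤ μu) :
    (Ctop / Cu) * μu ≤ (Cν / Cu) * (μu / μν) :=
  mul_le_mul (div_le_div_of_nonneg_right htop hCu.le) (le_div_self hμu hμν0 hμν1) hμu
    (div_nonneg (hCtop.trans htop) hCu.le)

/-- **(β) `V4_B5_reqM2 ⟹ ¬ IsPretransitive`** (sheet V4 (b) B5 «a G-set with r ≥ 2 orbits … defeats M2»; census O-13 residual `Req_V4_M2 G X r`): an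
indexing meeting L5-t8's `V4_B5_reqM2 G X r …` has `≥ 2` orbits, so the action is NOT pretransitive — the M2 forcing lemma
`LabelLaw.isUniform_of_symmetricUnder` (hypothesis `IsPretransitive`) has no instance to fire on it. [folklore] -/
theorem not_isPretransitive_of_reqM2 {G : Type*} [Group G] {X : Type*} [MulAction G X] {r : ℕ} {CN CS : Prop}
    (h : V4_B5_reqM2 G X r CN CS) : ¬ MulAction.IsPretransitive G X := by
  obtain ⟨hcount, hr, -, -, -⟩ := h
  intro hpre
  unfold HasOrbitCount at hcount
  have hsub : Subsingleton (MulAction.orbitRel.Quotient G X) := ⟨fun a b => by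
    induction a using Quotient.inductionOn with
    | h x =>
      induction b using Quotient.inductionOn with
      | h y =>
        obtain ⟨g, rfl⟩ := MulAction.exists_smul_eq G y x
        exact Quotient.sound (MulAction.orbitRel_apply.2 (MulAction.mem_orbit y g))⟩
  rcases isEmpty_or_nonempty (MulAction.orbitRel.Quotient G X) with he | ⟨⟨a⟩⟩
  · rw [Nat.card_of_isEmpty] at hcount
    omega
  · rw [Nat.card_of_subsingleton a] at hcount
    omega

/-- **(γ / V4B A2) The trivial label symmetry fixes EVERY law** (sheet V4B (a) A2 «the symmetry hypothesis is `LabelLaw.SymmetricUnder (⊥ : Subgroup _)`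
… the B5(γ) extreme»): orientation («G = 1») imposes nothing on the measure. [folklore] -/
theorem symmetricUnder_bot (L : LabelLaw n) : L.SymmetricUnder (⊥ : Subgroup (Equiv.Perm (Fin n))) := by
  intro g i
  have hg : (g : Equiv.Perm (Fin n)) = 1 := Subgroup.mem_bot.mp g.2
  rw [Subgroup.smul_def, hg, one_smul]

/-- **(γ / V4B A2) … and is NOT pretransitive for `l⋆ ≥ 2`** (V4B A2 «`isUniform_of_symmetricUnder` has NO instance to fire … so M2 imposes nothing»;
the mechanism left is M1 = `V4_B4_reqM1`). [folklore] -/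
theorem not_isPretransitive_bot (hn : 2 ≤ n) : ¬ MulAction.IsPretransitive (⊥ : Subgroup (Equiv.Perm (Fin n))) (Fin n) := by
  intro h
  obtain ⟨g, hg⟩ := MulAction.exists_smul_eq (⊥ : Subgroup (Equiv.Perm (Fin n))) (⟨0, by omega⟩ : Fin n) ⟨1, by omega⟩
  have hg1 : (g : Equiv.Perm (Fin n)) = 1 := Subgroup.mem_bot.mp g.2
  rw [Subgroup.smul_def, hg1, one_smul] at hg
  exact absurd (congrArg Fin.val hg) (by simp)
end V4Constant

section V4Door
open Summit.ABC.IUTFork Summit.ABC.IUTFork.Thm311 Summit.ABC.IUTFork.Cor312 Summit.ABC.IUTFork.Cor312.Setting Summit.ABC.IUTFork.Cor312Vol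
  Summit.ABC.IUTFork.Repair.RH.SigmaLicence Summit.ABC.IUTFork.Repair.RH.SigmaMass Literature.IUT.LogThetaLattice

variable {T : ThetaIndex} {S : Situation T} (P : Cor312.Setting S)

/-- At print's uniform law the `ν`-Corollary up to `ε` IS `StatementUpTo P ε` (L5-t8's `lawStatementUpTo_uniform_zero_iff` at every `ε`). [folklore] -/
theorem lawStatementUpTo_uniform_iff (hn : 0 < T.lstar) (ε : ℝ) :
    LawStatementUpTo P (LabelLaw.uniform hn) ε ↔ StatementUpTo P ε := by
  unfold LawStatementUpTo negLogThetaLaw negLogQLaw StatementUpTo Cor312.Setting.negLogTheta Cor312.Setting.negLogQ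
  simp only [lawNormalized_uniform]

variable {P}

/-- **(β) `V4_B6_labelLawDoor` AT THE UNIFORM LAW IS THE LANDED WEIGHTED DOOR** (sheet V4 (b) B6 «the ν-analogue of the weighted door p480491 … NOT
TYPED … the load-bearing missing object of any V4-relaxation»; census O-13 «LIVE — AS A GLOBAL-LAW QUESTION at the MEASURE level»): with
`d := cellDeficit`, `t := cellTrivialCost`, `ν = 1/l⋆`, L5-t8's door HOLDS under the bridge hypotheses — it IS p480491's
`statementUpTo_weightedTrivialMass_of_weightedDeficit_nonpos`; so the requirement is open EXACTLY for `ν ≠ 1/l⋆`. [claim: Mochizuki2012, status: disputed] -/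
theorem V4_B6_labelLawDoor_uniform (H : BridgeHyps P) (hn : 0 < T.lstar) :
    V4_B6_labelLawDoor P (LabelLaw.uniform hn) (fun c => cellDeficit P c.1 c.2) (cellTrivialCost P) := by
  intro ω hω h
  rw [lawStatementUpTo_uniform_iff, lawNormalized_uniform]
  rw [lawNormalized_uniform] at h
  exact statementUpTo_weightedTrivialMass_of_weightedDeficit_nonpos H hω h
end V4Door

section V4BInert
variable {X : Type*} [Fintype X]

/-- Reindexing by an involution `σ` under which the column is EVEN: `Σ_t ν(σ t)·col t = Σ_t ν t·col t`. [folklore] -/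
theorem sum_law_comp_mul_eq (σ : X → X) (hσ : Function.Involutive σ) (col : X → ℝ) (hcol : ∀ t, col (σ t) = col t) (ν : X → ℝ) :
    ∑ t, ν (σ t) * col t = ∑ t, ν t * col t :=
  calc ∑ t, ν (σ t) * col t = ∑ t, ν (σ t) * col (σ t) := Finset.sum_congr rfl fun t _ => by rw [hcol]
    _ = ∑ t, ν t * col t := Equiv.sum_comp (Function.Involutive.toPerm σ hσ) (fun t => ν t * col t)

/-- **(γ) THE V4B INERTNESS LEMMA** (sheet V4B §0 «with print's EVEN value law … every cell column at −t equals the column at t … K_ν, M_ν and E_ν[j+1]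
depend on ν only through its push-forward ν̄ … G_oriented(T) = G(T) on every datum (0 new cells)»; word A4 `V4B_inert_even`), over ANY finite label
type `X` with an involution `σ`, the even-law hypothesis `col (σ t) = col t` EXPLICIT: two laws with the same symmetrisation `t ↦ ν t + ν (σ t)` give
the same functional `Σ_t ν t·col t`. [folklore] -/
theorem sum_law_mul_eq_of_even (σ : X → X) (hσ : Function.Involutive σ) (col : X → ℝ) (hcol : ∀ t, col (σ t) = col t)
    {ν ν' : X → ℝ} (h : ∀ t, ν t + ν (σ t) = ν' t + ν' (σ t)) : ∑ t, ν t * col t = ∑ t, ν' t * col t := by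
  have e1 := sum_law_comp_mul_eq σ hσ col hcol ν
  have e2 := sum_law_comp_mul_eq σ hσ col hcol ν'
  have e3 : ∑ t, (ν t + ν (σ t)) * col t = ∑ t, (ν' t + ν' (σ t)) * col t :=
    Finset.sum_congr rfl fun t _ => by rw [h]
  simp only [add_mul, Finset.sum_add_distrib] at e3
  linarith

/-- **(γ) … on the ORIENTED label set `𝔽_l` with `σ = (t ↦ −t)`** (labels as ELEMENTS of `ZMod l`, no `±`-quotient in the data; the even law
`col (−t) = col t` is print's `q^{t²}` / container-`(|t|+1)` bookkeeping): every `ν`-functional of an even column is blind to orientation. [folklore] -/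
theorem sum_law_mul_eq_of_even_zmod {l : ℕ} [NeZero l] (col : ZMod l → ℝ) (hcol : ∀ t, col (-t) = col t) {ν ν' : ZMod l → ℝ}
    (h : ∀ t, ν t + ν (-t) = ν' t + ν' (-t)) : ∑ t, ν t * col t = ∑ t, ν' t * col t :=
  sum_law_mul_eq_of_even (fun t : ZMod l => -t) neg_involutive col hcol h

/-- **(γ) … hence every E-type quotient `C·(Σ ν·e)/(Σ ν·g)` of two even columns is orientation-inert** (`E^f(ν;T) = C^f(ν,l)/μ^f_ν` and the E-ratio
`G` are built from such sums; sheet V4B (c) C1 «the G-table at G = 1 under PRINT's value law = tst-2's V4-R2-OPT table BY NAME»). [folklore] -/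
theorem eRatio_eq_of_even_zmod {l : ℕ} [NeZero l] (e g : ZMod l → ℝ) (he : ∀ t, e (-t) = e t) (hg : ∀ t, g (-t) = g t) (C : ℝ)
    {ν ν' : ZMod l → ℝ} (h : ∀ t, ν t + ν (-t) = ν' t + ν' (-t)) :
    C * (∑ t, ν t * e t) / ∑ t, ν t * g t = C * (∑ t, ν' t * e t) / ∑ t, ν' t * g t := by
  rw [sum_law_mul_eq_of_even_zmod e he h, sum_law_mul_eq_of_even_zmod g hg h]
end V4BInert

/-! ## §V6. Sheet V6 (census O-15) — the floor's ledger identity, the rounding MEETS law, rigidity against a finer filtration -/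

section V6Floor
open Summit.ABC.IUTFork.Repair.RH.DiffPricedHull Summit.ABC.IUTFork.Repair.RH.ReqsideShellProfile

/-- The floor as «threshold minus integral-structure gain»: `e·⌊x/e⌋ = x − (x mod e)`. [folklore] -/
theorem floor_mul_eq_sub_emod (e x : ℤ) : e * (x / e) = x - x % e := by
  linarith [Int.mul_ediv_add_emod x e]

/-- **(α) LEDGER IDENTITY `thr(floor) = thr(none) − ρ_j`** (sheet V6 header «thr_j = e_w·⌊(j²·m_q − j·D − (j+1)·R_in)/e_w⌋ + (j+1)·R_out»; rh3-tst-2's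
«m_j(none) = m_j(floor) − ρ_j, ρ_j ∈ [0, e_w)»): print's rounded cell `HullCellδ` is the floor-free («rounding none») cell with its threshold LOWERED by
the gain `ρ_j = (j²m − jδ − (j+1)r_in) mod e ∈ [0, e)` (`HullCellSlice.gain_bounds`). [folklore] -/
theorem hullCellδ_iff_floorFree_sub_frac (e m j δ rin rout : ℤ) :
    HullCellδ e m j δ rin rout ↔
      (j ^ 2 * m - j * δ - (j + 1) * rin) - (j ^ 2 * m - j * δ - (j + 1) * rin) % e ≤ m - (j + 1) * rout := by
  unfold HullCellδ
  rw [floor_mul_eq_sub_emod]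

/-- **(α) THE FLOOR-ROUNDING MEETS LAW** (sheet V6 (c1)/(c2) «Flips are one-way (lost only, 0 gained, every tier/μ₀) … “Flips one-way” is the kernel's
`roundingNoneCell_le_print` on the bed»; census O-15 «KILLED-BY-DATA (kept-lowering: 0 cells gained on any bed)»; bed: MEETS@1 25 → 20/133 · 52 →
51/79 · 218 → 212/482 with the floor removed, never the other way): at a place `(e, m, δ, r_in, r_out)`, `0 < e`, for any finite label set `J` and
demands `d ≥ 0`, the licence-tier kept mass with the rounding REMOVED is at most the kept mass under print's floor — licensed(none) ⊆ licensed(floor)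
cell by cell (p507493); hence `thr ≤ kept(none) ⟹ thr ≤ kept(floor)` (MEETS) at every threshold, and place aggregation with `ũ_w ≥ 0` preserves it. [folklore] -/
theorem keptLIC_roundingNone_le_floor {e m δ rin rout : ℤ} (he : 0 < e) (J : Finset ℤ) (d : ℤ → ℤ) (hd : ∀ j ∈ J, 0 ≤ d j)
    [DecidablePred fun j : ℤ => HullCellδ e m j δ rin rout] :
    ∑ j ∈ J.filter (fun j => j ^ 2 * m - j * δ - (j + 1) * rin ≤ m - (j + 1) * rout), d j ≤
      ∑ j ∈ J.filter (fun j => HullCellδ e m j δ rin rout), d j := by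
  refine Finset.sum_le_sum_of_subset_of_nonneg (fun j hj => ?_) fun j hj _ => hd j (Finset.mem_filter.mp hj).1
  rw [Finset.mem_filter] at hj ⊢
  exact ⟨hj.1, roundingNoneCell_le_print he hj.2⟩
end V6Floor

section V6Packet
open Literature.IUT.LogVolume
open scoped Pointwise

variable (p : ℕ) [Fact p.Prime]
variable {I : Type}
variable (k : I → Type) [∀ i, NontriviallyNormedField (k i)] [∀ i, NormedAlgebra ℚ_[p] (k i)]

/-- `p^0 • U = U` for the packet powers `ppow` (`TensorPacketRing`). [folklore] -/
theorem ppow_zero_smul (U : Set (PacketAlgebra p k)) : ppow p k 0 • U = U := by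
  unfold ppow
  rw [zpow_zero, map_one, one_smul]

/-- **(β) ORBIT-MODULE RIGIDITY KILLS THE FINER STABLE FILTRATION** (sheet V6 (b) R-V6-1 «`FinerStableFiltration` … `(Fil : ℤ → Submodule ℤ_[p] V)`,
`(∀ n, Fil (n·e) = p^n • logPacket) ∧ StrictAnti Fil ∧ (∀ φ ∈ G, ∀ t, φ '' Fil t = Fil t)` … typed obstruction `OrbitModuleRigidity`»; census O-15
residual): ASSUMING L5-t8's `V6_R1_orbitModuleRigidity p k` (a hypothesis: typed ≠ proved), NO refinement index `e ≥ 2` admits a strictly decreasing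
filtration by additive SUBGROUPS with `Fil(n·e) = p^n·L`, stable under a group containing every log-packet automorphism — `Fil 1` would be a stable
subgroup strictly between `p·L` and `L`. (L5-t8's `V6_R1_finerStableFiltration` types `Fil` as bare sets, where the obstruction is silent; this is
the sheet's subgroup/submodule reading.) KILLED-BY-CONSISTENCY modulo the obstruction; nothing here proves it. [claim: Mochizuki2012, status: disputed] -/
theorem no_finerSubgroupFiltration_of_orbitModuleRigidity (hrig : V6_R1_orbitModuleRigidity p k) {e : ℕ} (he : 2 ≤ e)
    (G : Set (PacketAlgebra p k ≃ₗ[ℚ_[p]] PacketAlgebra p k)) (Fil : ℤ → AddSubgroup (PacketAlgebra p k))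
    (hlev : ∀ n : ℤ, (Fil (n * e) : Set (PacketAlgebra p k)) = ppow p k n • (logPacket p k : Set (PacketAlgebra p k)))
    (hanti : StrictAnti Fil) (hstab : ∀ φ ∈ G, ∀ t, φ '' (Fil t : Set (PacketAlgebra p k)) = Fil t)
    (hG : ∀ φ, IsLogPacketAut p k φ → φ ∈ G) : False := by
  have h0 : (Fil 0 : Set (PacketAlgebra p k)) = logPacket p k := by
    have h := hlev 0
    rwa [zero_mul, ppow_zero_smul] at h
  have h1 : (Fil e : Set (PacketAlgebra p k)) = ppow p k 1 • (logPacket p k : Set (PacketAlgebra p k)) := by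
    have h := hlev 1
    rwa [one_mul] at h
  have he' : (1 : ℤ) < (e : ℤ) := by exact_mod_cast he
  have hlt : Fil (e : ℤ) < Fil 1 := hanti he'
  have hlt' : Fil 1 < Fil 0 := hanti zero_lt_one
  obtain ⟨-, x, hx1, hxe⟩ := SetLike.lt_iff_le_and_exists.mp hlt
  have hxL : x ∈ (logPacket p k : Set (PacketAlgebra p k)) := by
    rw [← h0]
    exact hlt'.le hx1
  have hxp : x ∉ ppow p k 1 • (logPacket p k : Set (PacketAlgebra p k)) := by
    rw [← h1]
    exact hxe
  have hsub := hrig (Fil 1) (fun φ hφ => hstab φ (hG φ hφ) 1) ⟨x, hx1, hxL, hxp⟩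
  have hle : Fil 0 ≤ Fil 1 := by
    intro y hy
    have hy' : y ∈ (Fil 0 : Set (PacketAlgebra p k)) := hy
    rw [h0] at hy'
    exact hsub hy'
  exact lt_irrefl (Fil 1) (lt_of_lt_of_le hlt' hle)
end V6Packet

open Literature.IUT.LogVolume in
/-- **(β, BY NAME) `V6_R1_orbitModuleRigidity ⟹ ¬ V6_R1_finerStableSubgroupFiltration`** (abc-iut-L5-t8's part-C v2 `Prop` = sheet R-V6-1's signature in the
obstruction's AddSubgroup currency; census O-15), for every refinement index `e ≥ 2` and every indeterminacy predicate `Ind` containing the log-packet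
automorphisms. THE KILL IS OF THE SUBGROUP FORM: set-valued filtrations (the weaker `V6_R1_finerStableFiltration`, cf. `finerStableFiltration_of_subgroup`)
stay outside rigidity's reach (L5-t8 kills them only modulo the STRONGER `V6_R1_orbitTransitivity`); both obstructions stay hypotheses (typed ≠ proved).
KILLED as typed at our interface only; nothing about [IUTchIV] Prop 1.2 is asserted. [claim: Mochizuki2012, status: disputed] -/
theorem not_finerStableSubgroupFiltration_of_orbitModuleRigidity (p : ℕ) [Fact p.Prime] {I : Type} (k : I → Type)
    [∀ i, NontriviallyNormedField (k i)] [∀ i, NormedAlgebra ℚ_[p] (k i)] (hrig : V6_R1_orbitModuleRigidity p k) {e : ℕ} (he : 2 ≤ e)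
    {Ind : (PacketAlgebra p k ≃ₗ[ℚ_[p]] PacketAlgebra p k) → Prop} (hInd : ∀ φ, IsLogPacketAut p k φ → Ind φ) :
    ¬ V6_R1_finerStableSubgroupFiltration p k e Ind := fun ⟨G, Fil, hlev, hanti, hstab, hG⟩ =>
  no_finerSubgroupFiltration_of_orbitModuleRigidity p k hrig he G Fil hlev hanti hstab fun φ hφ => hG φ (hInd φ hφ)

end Summit.ABC.IUTFork.Repair.RH.Round4ConstraintFacesEven

end
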